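import Literature.Geometry.Lorentzian.IPlusRegular
import Literature.Geometry.Lorentzian.KillingOnIntegralCurveUnique
import Mathlib.Geometry.Manifold.PartitionOfUnity
import Mathlib.Geometry.Manifold.Instances.Sphere
import HarnessLib

/-!
# Crux `HawkingExtensionIsKerr` (stmt-FinalStateConjecture-17840), line `SketchIdeator2` —
# programme SEC, the section: the smooth height function (lead c7)

Helper file of the line lead (c7) for programme SEC, registered sub-goal `stub_sec_height`.
Given a finite family of K-charts `(Wᵢ, Oᵢ, χᵢ, χiᵢ)` of the horizon with uniform `s`-room `2δ`
covering a compact set `C ⊆ 𝓔⁺` by sets `Vᵢ` (open in `C`, on which `|χᵢ · 0| < δ/2`), and a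
`C^∞` structure on `C` in which the leaf coordinates `fᵢ = (χᵢ · 2, χᵢ · 3)` are smooth on `Vᵢ`, a
smooth partition of unity `ρ` subordinate to `(Vᵢ)` yields the HEIGHT `τ := -∑ⱼ ρⱼ · (χⱼ · 0)`
(`|τ| ≤ δ/2`) for which every `hᵢ := χᵢ · 0 + τ = ∑ⱼ ρⱼ (χᵢ · 0 - χⱼ · 0)` is smooth on `Vᵢ`:
the differences `χᵢ · 0 - χⱼ · 0` are holonomies of the `K`-foliation — the `0`-coordinate of
`χᵢ` at the chart-`j` slice point `χiⱼ (ι₀ (fⱼ ·))`, reached along the common chart line of the two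
charts (uniqueness of integral curves of the Killing field inside `U`) — hence smooth functions of
`fⱼ`.  The section of SEC is the point at `K`-time `τ` on the leaf through each point of `C`.
-/

noncomputable section

set_option linter.dupNamespace false

namespace Summit.FinalStateConjecture.FinalStateConjecture.Theorems.HawkingExtensionIsKerr.SketchIdeator2

open Set Filter Bundle Function Literature.Geometry.Lorentzian
open scoped Manifold ContDiff Topology

set_option maxHeartbeats 1600000 in
/-- **The smooth height function of the section (registered sub-goal `stub_sec_height`).**  See the
module docstring: `τ = -∑ⱼ ρⱼ (χⱼ · 0)` for a smooth partition of unity subordinate to the leaf-chart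
domains; `|τ| ≤ δ/2` and `χᵢ · 0 + τ` is `C^∞` on `Vᵢ`. -/
theorem stub_sec_height : ∀ (𝓑 : StationaryAFBlackHole.{0}) [𝓑.metric.HasLeviCivita] (U : Set 𝓑.carrier) (K : Π x : 𝓑.carrier, TangentSpace (𝓡 4) x), IsOpen U → 𝓑.metric.toPseudoRiemannianMetric.IsKillingFieldOn K U → ∀ (C : Set 𝓑.carrier), C ⊆ 𝓑.horizon → Nonempty (↥C ≃ₜ Metric.sphere (0 : E3) 1) → ∀ (N : ℕ) (δ : ℝ) (W : Fin N → Set 𝓑.carrier) (O : Fin N → Set E4) (χ : Fin N → 𝓑.carrier → E4) (χi : Fin N → E4 → 𝓑.carrier) (V : Fin N → Set ↥C) (f : Fin N → ↥C → EuclideanSpace ℝ (Fin 2)), 0 < δ → (∀ i, IsOpen (W i) ∧ IsOpen (O i) ∧ W i ⊆ U ∧ (∀ x ∈ W i, χ i x ∈ O i ∧ χi i (χ i x) = x) ∧ (∀ y ∈ O i, χi i y ∈ W i ∧ χ i (χi i y) = y) ∧ ContMDiffOn (𝓡 4) 𝓘(ℝ, E4) ∞ (χ i) (W i) ∧ ContMDiffOn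 𝓘(ℝ, E4) (𝓡 4) ∞ (χi i) (O i) ∧ (∀ x ∈ W i, x ∈ 𝓑.horizon ↔ χ i x 1 = 0) ∧ (∀ x ∈ W i, ∀ a b : ℝ, (∀ σ ∈ Ioo a b, χ i x + σ • EuclideanSpace.single 0 1 ∈ O i) → IsMIntegralCurveOn (fun σ : ℝ ↦ χi i (χ i x + σ • EuclideanSpace.single 0 1)) K (Ioo a b))) → (∀ i, ∀ x ∈ W i, |χ i x 0| < δ → ∀ s : ℝ, |s| < 2 * δ → (χ i x - (χ i x 0) • EuclideanSpace.single 0 1) + s • EuclideanSpace.single 0 1 ∈ O i) → (∀ i, IsOpen (V i)) → (∀ c : ↥C, ∃ i, c ∈ V i) → (∀ i, ∀ c ∈ V i, c.1 ∈ W i ∧ |χ i c.1 0| < δ / 2) → (∀ i, ∀ c ∈ V i, f i c 0 = χ i c.1 2 ∧ f i c 1 = χ i c.1 3) → ∀ [ChartedSpace (EuclideanSpace ℝ (Fin 2)) ↥C] [IsManifold (𝓡 2) ∞ ↥C], (∀ i, ContMDiffOn (𝓡 2) 𝓘(ℝ, EuclideanSpace ℝ (Fin 2)) ∞ (f i) (V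 i)) → ∃ τ : ↥C → ℝ, (∀ c, |τ c| ≤ δ / 2) ∧ (∀ i, ContMDiffOn (𝓡 2) 𝓘(ℝ, ℝ) ∞ (fun c : ↥C ↦ χ i c.1 0 + τ c) (V i)) := by
  intro 𝓑 _ U K hU hK C hCH eC N δ W O χ χi V f hδ hch hroom hVo hcov hV hf _ _ hfs
  obtain ⟨e⟩ := eC
  haveI : CompactSpace ↥C := e.symm.compactSpace
  haveI : T2Space ↥C := e.symm.t2Space
  set e0 : E4 := EuclideanSpace.single 0 1 with he0
  -- ## the partition of unity
  obtain ⟨ρ, hρ⟩ := SmoothPartitionOfUnity.exists_isSubordinate (𝓡 2) isClosed_univ V hVo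
    (fun c _ ↦ mem_iUnion.2 (hcov c))
  -- ## the height
  refine ⟨fun c ↦ -∑ᶠ j, ρ j c • χ j c.1 0, fun c ↦ ?_, fun i ↦ ?_⟩
  · -- ### the bound `|τ| ≤ δ/2`
    have hmem : ∑ᶠ j, ρ j c • χ j c.1 0 ∈ Icc (-(δ / 2)) (δ / 2) := by
      refine ρ.finsum_smul_mem_convex (g := fun j (c' : ↥C) ↦ χ j c'.1 0) (mem_univ c) (fun j hj ↦ ?_)
        (convex_Icc (𝕜 := ℝ) (-(δ / 2)) (δ / 2))
      have hcV : c ∈ V j := hρ j (subset_tsupport _ hj)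
      have hlt := (hV j c hcV).2
      exact ⟨by linarith [neg_abs_le (χ j c.1 0)], by linarith [le_abs_self (χ j c.1 0)]⟩
    rw [abs_le]
    exact ⟨by linarith [hmem.2], by linarith [hmem.1]⟩
  · -- ### smoothness of `hᵢ = χᵢ · 0 + τ` on `Vᵢ`
    intro c hc
    -- rewrite `hᵢ` as a partition-of-unity sum of holonomies near `c`
    have hsum1 : ∀ c' : ↥C, ∑ j, ρ j c' = 1 := fun c' ↦ by
      rw [← finsum_eq_sum_of_fintype]; exact ρ.sum_eq_one (mem_univ c')
    have hrepr : ∀ c' : ↥C, χ i c'.1 0 + -∑ᶠ j, ρ j c' • χ j c'.1 0 =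
        ∑ᶠ j, ρ j c' • (χ i c'.1 0 - χ j c'.1 0) := by
      intro c'
      simp only [finsum_eq_sum_of_fintype, smul_eq_mul, mul_sub, Finset.sum_sub_distrib,
        ← Finset.sum_mul, hsum1 c', one_mul]
      ring
    have heq : (fun c' : ↥C ↦ χ i c'.1 0 + -∑ᶠ j, ρ j c' • χ j c'.1 0) =
        fun c' ↦ ∑ᶠ j, ρ j c' • (χ i c'.1 0 - χ j c'.1 0) := funext hrepr
    show ContMDiffWithinAt (𝓡 2) 𝓘(ℝ, ℝ) ∞
      (fun c' : ↥C ↦ χ i c'.1 0 + -∑ᶠ j, ρ j c' • χ j c'.1 0) (V i) c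
    rw [heq]
    refine (ρ.contMDiffAt_finsum (x₀ := c) (g := fun j c' ↦ χ i c'.1 0 - χ j c'.1 0)
      fun j hj ↦ ?_).contMDiffWithinAt
    -- ### the holonomy `χᵢ · 0 - χⱼ · 0` is smooth at `c ∈ Vᵢ ∩ Vⱼ`
    have hcj : c ∈ V j := hρ j hj
    obtain ⟨hWio, hOi, hWiU, hinvi, hinvi', hχsi, hχii, hhori, hlinei⟩ := hch i
    obtain ⟨_, hOj, hWjU, hinvj, hinvj', _, hχij, hhorj, hlinej⟩ := hch j
    -- the transversal embedding `ι₀ : E2 → E4`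
    set ι0 : EuclideanSpace ℝ (Fin 2) →L[ℝ] E4 :=
      (EuclideanSpace.proj (0 : Fin 2)).smulRight (EuclideanSpace.single (2 : Fin 4) (1 : ℝ)) +
        (EuclideanSpace.proj (1 : Fin 2)).smulRight (EuclideanSpace.single (3 : Fin 4) (1 : ℝ)) with hι0
    have hι0_apply : ∀ w : EuclideanSpace ℝ (Fin 2), ι0 w =
        (w 0) • EuclideanSpace.single (2 : Fin 4) (1 : ℝ) + (w 1) • EuclideanSpace.single (3 : Fin 4) (1 : ℝ) :=
      fun w ↦ rfl
    -- the base point identity `χⱼ x - (χⱼ x 0) e₀ = ι₀ (fⱼ x)` on `Vⱼ`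
    have hbase : ∀ c' : ↥C, c' ∈ V j → χ j c'.1 - (χ j c'.1 0) • e0 = ι0 (f j c') := by
      intro c' hc'
      have hx : c'.1 ∈ W j := (hV j c' hc').1
      have h1 : χ j c'.1 1 = 0 := (hhorj _ hx).1 (hCH c'.2)
      obtain ⟨hf0, hf1⟩ := hf j c' hc'
      rw [hι0_apply]
      ext k
      fin_cases k <;> simp [he0, h1, hf0, hf1]
    -- the holonomy function `G w := (χᵢ (χiⱼ (ι₀ w))) 0`, smooth on an open set containing `fⱼ c`
    set Ω : Set (EuclideanSpace ℝ (Fin 2)) := {w | ι0 w ∈ O j ∧ χi j (ι0 w) ∈ W i} with hΩ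
    -- the slice point of chart `j` through `x ∈ Vᵢ ∩ Vⱼ` lies in `Wᵢ`, with `χᵢ`-coordinate `0` equal
    -- to `χᵢ x 0 - χⱼ x 0` (the common chart line)
    have hslice : ∀ c' : ↥C, c' ∈ V i → c' ∈ V j →
        χi j (χ j c'.1 - (χ j c'.1 0) • e0) ∈ W i ∧
          χ i (χi j (χ j c'.1 - (χ j c'.1 0) • e0)) 0 = χ i c'.1 0 - χ j c'.1 0 := by
      intro c' hci' hcj'
      obtain ⟨hxi, hsi⟩ := hV i c' hci'
      obtain ⟨hxj, hsj⟩ := hV j c' hcj'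
      -- both chart lines through `x` on `Ioo (-δ) δ`
      have hsegi : ∀ σ ∈ Ioo (-δ) δ, χ i c'.1 + σ • e0 ∈ O i := by
        intro σ hσ
        have h := hroom i c'.1 hxi (by linarith [hsi]) (χ i c'.1 0 + σ)
          (by rw [abs_lt] at hsi ⊢; constructor <;> linarith [hσ.1, hσ.2, hsi.1, hsi.2])
        have : χ i c'.1 - (χ i c'.1 0) • e0 + (χ i c'.1 0 + σ) • e0 = χ i c'.1 + σ • e0 := by
          rw [add_smul]; abel
        rwa [this] at h
      have hsegj : ∀ σ ∈ Ioo (-δ) δ, χ j c'.1 + σ • e0 ∈ O j := by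
        intro σ hσ
        have h := hroom j c'.1 hxj (by linarith [hsj]) (χ j c'.1 0 + σ)
          (by rw [abs_lt] at hsj ⊢; constructor <;> linarith [hσ.1, hσ.2, hsj.1, hsj.2])
        have : χ j c'.1 - (χ j c'.1 0) • e0 + (χ j c'.1 0 + σ) • e0 = χ j c'.1 + σ • e0 := by
          rw [add_smul]; abel
        rwa [this] at h
      have hcoin := hK.eqOn_of_isMIntegralCurveOn hU isOpen_Ioo ordConnected_Ioo
        (show (0 : ℝ) ∈ Ioo (-δ) δ from ⟨by linarith, hδ⟩) (hlinei c'.1 hxi (-δ) δ hsegi)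
        (hlinej c'.1 hxj (-δ) δ hsegj) (fun σ hσ ↦ hWiU (hinvi' _ (hsegi σ hσ)).1)
        (fun σ hσ ↦ hWjU (hinvj' _ (hsegj σ hσ)).1)
        (by show χi i (χ i c'.1 + (0 : ℝ) • e0) = χi j (χ j c'.1 + (0 : ℝ) • e0)
            rw [zero_smul, add_zero, add_zero, (hinvi _ hxi).2, (hinvj _ hxj).2])
      have hσmem : -(χ j c'.1 0) ∈ Ioo (-δ) δ := by
        rw [abs_lt] at hsj; constructor <;> linarith [hsj.1, hsj.2]
      have hpt := hcoin hσmem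
      simp only at hpt
      have hrw : χ j c'.1 - (χ j c'.1 0) • e0 = χ j c'.1 + (-(χ j c'.1 0)) • e0 := by
        rw [neg_smul, sub_eq_add_neg]
      rw [hrw, ← hpt]
      have hOmem := hsegi _ hσmem
      refine ⟨(hinvi' _ hOmem).1, ?_⟩
      rw [(hinvi' _ hOmem).2]
      simp [he0, sub_eq_add_neg]
    have hG : ContMDiffOn 𝓘(ℝ, EuclideanSpace ℝ (Fin 2)) 𝓘(ℝ, ℝ) ∞
        (fun w ↦ χ i (χi j (ι0 w)) 0) Ω := by
      have h1 : ContMDiffOn 𝓘(ℝ, EuclideanSpace ℝ (Fin 2)) (𝓡 4) ∞ (fun w ↦ χi j (ι0 w)) Ω :=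
        hχij.comp ι0.contMDiff.contMDiffOn (fun w hw ↦ hw.1)
      have h2 : ContMDiffOn 𝓘(ℝ, EuclideanSpace ℝ (Fin 2)) 𝓘(ℝ, E4) ∞ (fun w ↦ χ i (χi j (ι0 w))) Ω :=
        hχsi.comp h1 (fun w hw ↦ hw.2)
      exact ((EuclideanSpace.proj (0 : Fin 4)).contMDiff.comp_contMDiffOn h2 :)
    have hΩo : IsOpen Ω := by
      have h1 : ContinuousOn (fun w ↦ χi j (ι0 w)) (ι0 ⁻¹' O j) :=
        hχij.continuousOn.comp ι0.continuous.continuousOn (fun w hw ↦ hw)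
      exact h1.isOpen_inter_preimage (hOj.preimage ι0.continuous) hWio
    -- `fⱼ c ∈ Ω`
    have hι0c : ∀ c' : ↥C, c' ∈ V j → ι0 (f j c') ∈ O j := by
      intro c' hc'
      rw [← hbase c' hc']
      have h := hroom j c'.1 (hV j c' hc').1 (by linarith [(hV j c' hc').2]) 0
        (by rw [abs_zero]; linarith)
      rwa [zero_smul, add_zero] at h
    have hmemΩ : f j c ∈ Ω := by
      refine ⟨hι0c c hcj, ?_⟩
      show χi j (ι0 (f j c)) ∈ W i
      rw [← hbase c hcj]
      exact (hslice c hc hcj).1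
    -- `G ∘ fⱼ` is smooth at `c` and agrees with the holonomy near `c`
    have hGf : ContMDiffAt (𝓡 2) 𝓘(ℝ, ℝ) ∞ (fun c' : ↥C ↦ χ i (χi j (ι0 (f j c'))) 0) c :=
      (hG.contMDiffAt (hΩo.mem_nhds hmemΩ)).comp c
        ((hfs j).contMDiffAt ((hVo j).mem_nhds hcj))
    refine hGf.congr_of_eventuallyEq ?_
    filter_upwards [(hVo i).mem_nhds hc, (hVo j).mem_nhds hcj] with c' hci' hcj'
    show χ i c'.1 0 - χ j c'.1 0 = χ i (χi j (ι0 (f j c'))) 0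
    rw [← hbase c' hcj', (hslice c' hci' hcj').2]

end Summit.FinalStateConjecture.FinalStateConjecture.Theorems.HawkingExtensionIsKerr.SketchIdeator2

end
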